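import Summits.Ventures.YMGap.RobustBall.RobustStarArray
import HarnessLib

/-!
# Venture YMGap, track ROBUST-BALL (Y2) — crux Y2-X2 for the FULL tier-1 ball, step 4: the RECEIVED SUM
# (H2) of the robust star array

HONEST FRAMING. WHAT THIS IS: a venture file (cell `pub-ymgap`, track Y2 ROBUST-BALL, seat ds-2); finite sums
and real arithmetic, NO measure, NO number. For the robust star array `Krob c E θ K = Karr c + Uarr` of
`RobustStarArray` (per-incidence coefficient `c ≥ 0` below the pole with `R_G^{(d)}(c) ≤ 1`, off-column
entries `E ≥ 0` with rows `∑_{z ≠ x} E x z ≤ λ`, in-star row bound `θ < 1`, Neumann depth `K`):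
**(H2)** `∑_y Krob c E θ K s y x ≤ R_G^{(d)}(c) + (λ + θ^K · 4dλ)/(1 − θ)` for every star link `x` —
ds-4's received sum `∑_y Karr = R_G^{(d)}(c)` PLUS the Neumann corrections, which are summed over the boundary
link `y` BEFORE the resolvent bound is taken (additivity of `StarNeumann.superSol` in the source): the summed
source is `λ_out(x) + R_G · λ_in(x) ≤ λ`, so the off-column entries cost `λ/(1−θ)` and NOT `2d · λ/(1−θ)`;
the remainder `θ^K · 4dλ/(1−θ)` of the finite Neumann depth is made as small as desired by `K`.
WHAT THIS IS NOT: no specification, no clustering statement; lattice bookkeeping only — nothing about the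
continuum or the Millennium problem.

## References
* H. Föllmer, LNM 1362 (1988) Ch. I (2.8)–(2.10); the tree: `StarLemmaGArrayDim.sum_Karr_eq_gaugeR` (ds-4).
-/

noncomputable section

open Finset Function
open Literature.MathematicalPhysics.QuantumFieldTheory
open Literature.MathematicalPhysics.QuantumFieldTheory.Balaban1983to89.StrongCouplingTorusWindow
open Summit.Ventures.YMGap.DSWindow
open Summit.Ventures.YMGap.StarKernel
open Summit.Ventures.YMGap.StarResolventDim (Delta gaugeR)
open Summit.Ventures.YMGap.StarLemmaGDim
open Summit.Ventures.YMGap.StarNeumann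

namespace Summit.Ventures.YMGap.RobustStar

variable {d L : ℕ} [NeZero L] {c θ lam : ℝ} {E : Edge d L → Edge d L → ℝ} {K : ℕ}

/-- `Karr` vanishes for `y` in the star (by definition). [folklore] -/
theorem Karr_eq_zero_of_mem {s : Site d L} {y : Edge d L} (hy : y ∈ vertexStar s) (x : Edge d L) :
    Karr c s y x = 0 := by
  simp only [Karr, if_neg (fun h : x ∈ vertexStar s ∧ y ∉ vertexStar s => h.2 hy)]

/-- The received sum of `Karr` over the links OFF the star is still `R_G^{(d)}(c)`. [folklore] -/
theorem sum_not_mem_Karr_eq_gaugeR (hL : 3 ≤ L) (hc : 0 ≤ c) (hΔ : 0 < Delta d c) {s : Site d L}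
    {x : Edge d L} (hx : x ∈ vertexStar s) :
    ∑ y ∈ univ.filter (fun y => y ∉ vertexStar s), Karr c s y x = gaugeR d c := by
  rw [← sum_Karr_eq_gaugeR hL hc hΔ hx, sum_filter]
  refine sum_congr rfl fun y _ => ?_
  by_cases hy : y ∈ vertexStar s
  · rw [if_neg (not_not.2 hy), Karr_eq_zero_of_mem hy]
  · rw [if_pos hy]

/-- **The summed source is at most `λ`**: `∑_{y ∉ ⋆} wsrc c E s y x ≤ λ` for a star link `x`, when
`R_G^{(d)}(c) ≤ 1` and the off-column rows are `≤ λ` (the out-of-star part of the row plus `R_G` times the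
in-star part). [folklore] -/
theorem sum_not_mem_wsrc_le (hL : 3 ≤ L) (hc : 0 ≤ c) (hΔ : 0 < Delta d c) (hgR : gaugeR d c ≤ 1)
    (hE : ∀ x z, 0 ≤ E x z) (hlam : ∀ x, ∑ z ∈ univ.erase x, E x z ≤ lam) {s : Site d L} {x : Edge d L}
    (hx : x ∈ vertexStar s) :
    ∑ y ∈ univ.filter (fun y => y ∉ vertexStar s), wsrc c E s y x ≤ lam := by
  unfold wsrc
  rw [sum_add_distrib]
  have hin : ∑ y ∈ univ.filter (fun y => y ∉ vertexStar s), ∑ z ∈ (vertexStar s).erase x, E x z * Karr c s y z =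
      ∑ z ∈ (vertexStar s).erase x, E x z * gaugeR d c := by
    rw [sum_comm]
    refine sum_congr rfl fun z hz => ?_
    rw [← mul_sum, sum_not_mem_Karr_eq_gaugeR hL hc hΔ (mem_of_mem_erase hz)]
  rw [hin]
  have hin_le : ∑ z ∈ (vertexStar s).erase x, E x z * gaugeR d c ≤ ∑ z ∈ (vertexStar s).erase x, E x z :=
    sum_le_sum fun z _ => by nlinarith [hE x z]
  have hsplit : ∑ y ∈ univ.filter (fun y => y ∉ vertexStar s), E x y + ∑ z ∈ (vertexStar s).erase x, E x z ≤
      ∑ z ∈ univ.erase x, E x z := by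
    rw [← sum_union]
    · refine sum_le_sum_of_subset_of_nonneg (fun z hz => ?_) fun z _ _ => hE x z
      rw [mem_union, mem_filter, mem_erase] at hz
      rcases hz with ⟨-, hz⟩ | ⟨hzx, -⟩
      · exact mem_erase.2 ⟨fun h => hz (h ▸ hx), mem_univ _⟩
      · exact mem_erase.2 ⟨hzx, mem_univ _⟩
    · rw [disjoint_left]
      intro z hz hz'
      exact (mem_filter.1 hz).2 (mem_of_mem_erase hz')
  linarith [hlam x]

/-- **The summed remainder constants**: `∑_{y ∉ ⋆} 2 Msrc c E s y ≤ 4dλ`. [folklore] -/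
theorem sum_not_mem_Msrc_le (hL : 3 ≤ L) (hc : 0 ≤ c) (hΔ : 0 < Delta d c) (hgR : gaugeR d c ≤ 1)
    (hE : ∀ x z, 0 ≤ E x z) (hlam : ∀ x, ∑ z ∈ univ.erase x, E x z ≤ lam) (s : Site d L) :
    ∑ y ∈ univ.filter (fun y => y ∉ vertexStar s), 2 * Msrc c E s y ≤ 4 * d * lam := by
  have hL1 : 1 < L := by omega
  unfold Msrc
  rw [← mul_sum, sum_comm]
  have h : ∑ x ∈ vertexStar s, ∑ y ∈ univ.filter (fun y => y ∉ vertexStar s), wsrc c E s y x ≤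
      ∑ x ∈ vertexStar s, lam := sum_le_sum fun x hx => sum_not_mem_wsrc_le hL hc hΔ hgR hE hlam hx
  rw [sum_const, card_vertexStar hL1 s, nsmul_eq_mul] at h
  push_cast at h
  linarith

/-- **(H2) FOR THE ROBUST STAR ARRAY.** For a star link `x` of `s` (`d ≥ 2`, side `≥ 3`, `c ≥ 0` below the
pole with `R_G^{(d)}(c) ≤ 1`, `E ≥ 0` with rows `≤ λ`, in-star rows of `Cst c E` at most `θ ∈ [0,1)`):
`∑_y Krob c E θ K s y x ≤ R_G^{(d)}(c) + (λ + θ^K · 4dλ)/(1 − θ)`. [folklore] -/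
theorem sum_Krob_le (hd : 2 ≤ d) (hL : 3 ≤ L) (hc : 0 ≤ c) (hΔ : 0 < Delta d c) (hgR : gaugeR d c ≤ 1)
    (hE : ∀ x z, 0 ≤ E x z) (hlam : ∀ x, ∑ z ∈ univ.erase x, E x z ≤ lam) (hθ0 : 0 ≤ θ) (hθ1 : θ < 1)
    {s : Site d L} (hrow : ∀ x ∈ vertexStar s, ∑ z ∈ (vertexStar s).erase x, Cst c E x z ≤ θ) {x : Edge d L}
    (hx : x ∈ vertexStar s) :
    ∑ y, Krob c E θ K s y x ≤ gaugeR d c + (lam + θ ^ K * (4 * d * lam)) / (1 - θ) := by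
  have h1θ : 0 < 1 - θ := by linarith
  have hlam0 : 0 ≤ lam := le_trans (sum_nonneg fun z _ => hE x z) (hlam x)
  -- split off the star
  have hsplit : ∑ y, Krob c E θ K s y x =
      ∑ y ∈ univ.filter (fun y => y ∉ vertexStar s), (Karr c s y x + Uarr c E θ K s y x) := by
    rw [sum_filter]
    refine sum_congr rfl fun y _ => ?_
    unfold Krob
    split_ifs with hy <;> rfl
  rw [hsplit, sum_add_distrib, sum_not_mem_Karr_eq_gaugeR hL hc hΔ hx]
  refine add_le_add le_rfl ?_
  -- the Neumann corrections: sum the sources first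
  unfold Uarr
  rw [sum_superSol]
  refine (superSol_le (Cst_nonneg hc hE) hθ0 hθ1 hrow (M' := lam) (fun x' hx' => ?_) hlam0 ?_ K x).trans ?_
  · exact sum_not_mem_wsrc_le hL hc hΔ hgR hE hlam hx'
  · exact sum_nonneg fun y _ => mul_nonneg zero_le_two (Msrc_nonneg hd hc hΔ hE s y)
  · have hM := sum_not_mem_Msrc_le hL hc hΔ hgR hE hlam s
    have hθK : 0 ≤ θ ^ K := pow_nonneg hθ0 K
    exact div_le_div_of_nonneg_right (by nlinarith) h1θ.le

end Summit.Ventures.YMGap.RobustStar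

end
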